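import Summits.KontsevichZagierPeriods.KontsevichZagierPeriods.Theorems.SoloInformedKZPOneKValues
import HarnessLib
import HarnessLib.Audit

/-!
# SoloInformed — piecewise `K`-rational integrands in one variable; absolute values

Solo programme `solo-KontsevichZagierPeriods-informed`, session s112, file 20.

The class of one-variable representations lying in the span of points and segments (hence
satisfying the Kontsevich–Zagier period conjecture among themselves, file 18) is closed under
semialgebraic SUBDIVISION of the domain: if `dom r` is covered, up to a null set and with null
overlaps, by finitely many `ℚ`-semialgebraic pieces `D_i` on each of which the integrand is
`P_i/Q_i` with `P_i, Q_i ∈ K[X]` (`K` = real algebraic numbers), `Q_i ≠ 0` on `D_i`, then `[r]` lies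
in the span (`soloInformed_segSpan_of_piecewise_K`; rule (1) + the `K`-rational theorem per piece).
Example: integrands `|P/Q|` (`soloInformed_segSpan_of_abs_K`, split by the sign of `P·Q`), hence the
period conjecture for absolutely convergent `∫_D |N/M| dx` among all these classes
(`soloInformed_kzp_abs_K`).

References: M. Kontsevich, D. Zagier, *Periods* (2001), §1.1–1.2; this work.
-/

noncomputable section

open scoped BigOperators Polynomial

namespace Summit.KontsevichZagierPeriods.KontsevichZagierPeriods.Theorems

open Set MeasureTheory
open Literature.ModelTheory.ExponentialFields
open Literature.NumberTheory.Transcendental Literature.NumberTheory.Transcendental.KZ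

/-- **Piecewise `K`-rational representations lie in the span of points and segments.**
[Kontsevich–Zagier 2001, §1.1 rule (1); this work] -/
theorem soloInformed_segSpan_of_piecewise_K {ι : Type*} [Fintype ι] (r : IntegralRep 1)
    (D : ι → Set (Fin 1 → ℝ)) (hD : ∀ i, IsSemialgebraic ℚ (D i)) (hsub : ∀ i, D i ⊆ r.domain)
    (hcov : volume (r.domain \ ⋃ i, D i) = 0)
    (hdisj : Pairwise fun i j => volume (D i ∩ D j) = 0)
    (P Q : ι → (algebraicClosure ℚ ℝ)[X])
    (hq : ∀ i, ∀ x ∈ D i, (Polynomial.aeval (x 0) (Q i) : ℝ) ≠ 0)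
    (hpq : ∀ i, EqOn r.integrand
      (fun x => (Polynomial.aeval (x 0) (P i) : ℝ) / Polynomial.aeval (x 0) (Q i)) (D i)) :
    of r ∈ soloInformedSegSpan := by
  classical
  set R : ι → IntegralRep 1 := fun i => r.restrict (D i) (hD i) (hsub i) with hR
  have hrel : of r - ∑ i, of (R i) ∈ relations := by
    refine of_sub_sum_of_mem_relations Finset.univ r R (fun i _ => ?_) (fun i _ _ _ => rfl) ?_
      fun i _ j _ hij => ?_
    · rw [show (R i).domain \ r.domain = ∅ from sdiff_eq_empty.mpr (hsub i), measure_empty]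
    · have h : r.domain \ ⋃ i ∈ (Finset.univ : Finset ι), (R i).domain = r.domain \ ⋃ i, D i := by
        congr 1
        ext x
        simp [hR]
      rw [h]
      exact hcov
    · exact hdisj hij
  refine soloInformed_mem_segSpan_of_sub_mem hrel (soloInformed_sum_mem_segSpan _ fun i _ =>
    soloInformed_segSpan_of_isKRationalOne (R i) ⟨P i, Q i, hq i, hpq i⟩)

/-- **Absolute values: `[D, |P/Q|]` lies in the span of points and segments** (`P, Q ∈ K[X]`,
`Q ≠ 0` on `D`): split `D` by the sign of `P·Q`. [this work] -/
theorem soloInformed_segSpan_of_abs_K (r : IntegralRep 1) {P Q : (algebraicClosure ℚ ℝ)[X]}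
    (hq : ∀ x ∈ r.domain, (Polynomial.aeval (x 0) Q : ℝ) ≠ 0)
    (hpq : EqOn r.integrand
      (fun x => |(Polynomial.aeval (x 0) P : ℝ) / Polynomial.aeval (x 0) Q|) r.domain) :
    of r ∈ soloInformedSegSpan := by
  classical
  set F : (Fin 1 → ℝ) → ℝ := fun x => (Polynomial.aeval (x 0) (P * Q) : ℝ) with hF
  have hFsa : IsSemialgebraicFunOn ℚ r.domain F := by
    -- a polynomial with real algebraic coefficients is a `ℚ`-semialgebraic function (read in `ℂ`)
    set V : ℂ[X] := ((P * Q).map soloInformedRealAlgHom).map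
      (algebraMap (algebraicClosure ℚ ℂ) ℂ) with hV
    have hVc : ∀ n, IsAlgebraic ℚ (V.coeff n) := fun n => by
      rw [hV, Polynomial.coeff_map, Polynomial.coeff_map]
      exact mem_algebraicClosure_iff.1 (soloInformedRealAlgHom ((P * Q).coeff n)).2
    refine (soloInformed_re_im_polyEval r.isSemialgebraic_domain V hVc
      (Literature.NumberTheory.Transcendental.isSemialgebraicFunOn_apply
        r.isSemialgebraic_domain 0)).1.congr fun x _ => ?_
    show (V.eval ((x 0 : ℝ) : ℂ)).re = _
    rw [hV, soloInformed_eval_map_realAlgHom, Complex.ofReal_re]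
  set Dp : Set (Fin 1 → ℝ) := {x | x ∈ r.domain ∧ 0 ≤ F x} with hDp
  set Dm : Set (Fin 1 → ℝ) := r.domain \ Dp with hDm
  have hDp_sa : IsSemialgebraic ℚ Dp := hFsa.isSemialgebraic_sep_nonneg
  have hDm_sa : IsSemialgebraic ℚ Dm := r.isSemialgebraic_domain.diff hDp_sa
  have hsign : ∀ x ∈ r.domain, (Polynomial.aeval (x 0) P : ℝ) / Polynomial.aeval (x 0) Q =
      F x / (Polynomial.aeval (x 0) Q) ^ 2 := fun x hx => by
    rw [hF]
    simp only [map_mul]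
    field_simp [hq x hx]
  -- the two pieces, indexed by `Bool`
  set D : Bool → Set (Fin 1 → ℝ) := fun b => if b then Dp else Dm with hD
  have hDsa : ∀ b, IsSemialgebraic ℚ (D b) := fun b => by
    cases b
    · exact hDm_sa
    · exact hDp_sa
  have hDsub : ∀ b, D b ⊆ r.domain := fun b => by
    cases b
    · exact fun x hx => hx.1
    · exact fun x hx => hx.1
  have hcov : volume (r.domain \ ⋃ b, D b) = 0 := by
    rw [show r.domain \ ⋃ b, D b = ∅ from ?_, measure_empty]
    refine Set.eq_empty_of_subset_empty fun x hx => ?_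
    rcases hx with ⟨hxD, hxU⟩
    apply hxU
    by_cases h : 0 ≤ F x
    · exact mem_iUnion.2 ⟨true, ⟨hxD, h⟩⟩
    · exact mem_iUnion.2 ⟨false, ⟨hxD, fun h' => h h'.2⟩⟩
  have hdisj : Pairwise fun b b' : Bool => volume (D b ∩ D b') = 0 := by
    intro b b' hne
    have h0 : D b ∩ D b' = ∅ := by
      cases b <;> cases b'
      · exact absurd rfl hne
      · exact Set.eq_empty_of_subset_empty fun x hx => hx.1.2 hx.2
      · exact Set.eq_empty_of_subset_empty fun x hx => hx.2.2 hx.1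
      · exact absurd rfl hne
    rw [h0, measure_empty]
  refine soloInformed_segSpan_of_piecewise_K r D hDsa hDsub hcov hdisj
    (fun b => if b then P else -P) (fun _ => Q) (fun b x hx => hq x (hDsub b hx)) fun b => ?_
  cases b
  · -- `Dm`: `P·Q < 0`, `|P/Q| = (-P)/Q`
    intro x hx
    have hxD : x ∈ r.domain := hx.1
    have hneg : F x < 0 := lt_of_not_ge fun h => hx.2 ⟨hxD, h⟩
    have hQ2 : 0 < (Polynomial.aeval (x 0) Q : ℝ) ^ 2 :=
      lt_of_le_of_ne (sq_nonneg _) (Ne.symm (pow_ne_zero 2 (hq x hxD)))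
    have hlt : (Polynomial.aeval (x 0) P : ℝ) / Polynomial.aeval (x 0) Q < 0 := by
      rw [hsign x hxD]
      exact div_neg_of_neg_of_pos hneg hQ2
    rw [hpq hxD]
    show |(Polynomial.aeval (x 0) P : ℝ) / Polynomial.aeval (x 0) Q| =
      (Polynomial.aeval (x 0) (-P) : ℝ) / Polynomial.aeval (x 0) Q
    rw [abs_of_neg hlt, map_neg, neg_div]
  · -- `Dp`: `P·Q ≥ 0`, `|P/Q| = P/Q`
    intro x hx
    have hxD : x ∈ r.domain := hx.1
    have hnn : 0 ≤ (Polynomial.aeval (x 0) P : ℝ) / Polynomial.aeval (x 0) Q := by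
      rw [hsign x hxD]
      exact div_nonneg hx.2 (sq_nonneg _)
    rw [hpq hxD]
    show |(Polynomial.aeval (x 0) P : ℝ) / Polynomial.aeval (x 0) Q| =
      (Polynomial.aeval (x 0) P : ℝ) / Polynomial.aeval (x 0) Q
    rw [abs_of_nonneg hnn]

/-- **The period conjecture for `∫_D |N/M| dx`** (and against the `K`-rational class and rational
representations of dimension `≤ 1`): equal values ⇒ KZ-equivalent. [this work] -/
theorem soloInformed_kzp_abs_K (r : IntegralRep 1) {P Q : (algebraicClosure ℚ ℝ)[X]}
    (hq : ∀ x ∈ r.domain, (Polynomial.aeval (x 0) Q : ℝ) ≠ 0)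
    (hpq : EqOn r.integrand
      (fun x => |(Polynomial.aeval (x 0) P : ℝ) / Polynomial.aeval (x 0) Q|) r.domain) :
    (∀ r' : IntegralRep 1, SoloInformedIsKRationalOne r' → r.value = r'.value → Equivalent r r') ∧
      ∀ {n : ℕ} (hn : n ≤ 1) (r₀ : IntegralRep n), r₀.IsRational → r.value = r₀.value →
        Equivalent r r₀ :=
  ⟨fun r' hr' hv => soloInformed_equivalent_of_mem_segSpan (soloInformed_segSpan_of_abs_K r hq hpq)
      (soloInformed_segSpan_of_isKRationalOne r' hr') hv,
    fun hn r₀ hr₀ hv => soloInformed_equivalent_of_mem_segSpan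
      (soloInformed_segSpan_of_abs_K r hq hpq)
      (soloInformed_of_mem_segSpan_of_isRational hn r₀ hr₀) hv⟩

end Summit.KontsevichZagierPeriods.KontsevichZagierPeriods.Theorems
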